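import Summits.HodgeConjecture.HodgeConjecture.Theorems.Ring2WeilCoverageCyclotomicTwistedObstruction
import Summits.HodgeConjecture.HodgeConjecture.Theorems.Ring2WeilCoverageRelativeNormPositivityLevels
import Summits.HodgeConjecture.HodgeConjecture.Theorems.Ring2WeilCoverageResidueDictionaryPiecesB
import Summits.HodgeConjecture.HodgeConjecture.Theorems.Ring2WeilCoverageCyclotomicUnconditionalSqrtFive
import HarnessLib

/-!
# Weil-type family coverage — the census level `M = 39` in the kernel: `√13` and `√(78 − 18√13)` in `ℚ(ζ₃₉)⁺`,
# the twisted NO verdict on both classes of places, and the row «(39, ℚ(√−3)) / (39, ℚ(√−39)): NO for every CM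
# type with `n₊₋(Φ)` EVEN» — hypothesis-free

research route conditional on HC_CM; not a corollary; Q11.4-sentence-2 already refuted in dim ≥ 3.

Ring 2, WEIL-TYPE FAMILY-COVERAGE CENSUS (`HOME/WEIL-FAMILY-COVERAGE.md` `## b01`, block b01.25 (A): «at `M = 39` …
`A_Φ` principal ⟺ `n₊₋(Φ) := #{t ∈ Φ : χ₁₃(t) = +1, χ_K(t) = −1}` is ODD (both `K = ℚ(√−3), ℚ(√−39)`) — 260/260
classes; the second `𝔽₂`-condition `λ` = every unit of `ℚ(ζ₃₉)⁺` has totally positive relative norm to `ℚ(√13)`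
(PARI)»; owner ring2-b01), part 36 of the `Ring2WeilCoverage*` series — the first INDEX-2 level made a
hypothesis-free tree theorem (NO direction), assembling parts 26b (dictionary for `√13`), 33/35 (twisted engine),
34b (relative-norm positivity at `(13, 78 − 18√13)`):

* §0 `odd_card_filter_inter_of` — the row bookkeeping (every level): from the twisted pair-count identity of part 35,
  `|S ∩ C ∩ N_odd| ≡ |S ∩ (C ∩ N_K)| + |C ∩ (N_odd ∖ N_K)|`, so a displayed parity of `n_C(Φ) = |S_Φ ∩ (C ∩ N_K)|`
  gives the odd twisted count the engine needs.
* §1 the elements (`η = ζ³` a primitive 13th root, `ω = ζ¹³`): `sq_gaussThirteen` (`(1 + 2Σ_{a ∈ QR₁₃} η^a)² = 13`),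
  `complexConj_gaussThirteen`, `two_mul_sq_piDiff` (`2(π₀ − π₂)² = −(13 − 3√13)` for the quartic Gauss periods
  `π₀ = η + η³ + η⁹`, `π₂ = η⁴ + η¹² + η¹⁰`), `complexConj_piDiff` (`π₀ − π₂` is purely imaginary) — so
  `w = 2(1 + 2ω)(π₀ − π₂) ∈ ℚ(ζ₃₉)⁺` has `w² = 78 − 18√13` (the real cyclic quartic field of conductor `39`).
* §2 **`not_exists_principal_thirtyNine_of_odd_on`**: for `K ⊇ ℚ(ζ₃₉)` cyclotomic CM, ANY CM type `Φ` and either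
  class `b` of `χ₁₃`: if `#{t ∈ S_Φ ∩ N_odd : (χ₁₃(t) = −1 ↔ b)}` is ODD then `ℂ^Φ/Φ(ℤ[ζ₃₉])` carries NO
  `ι`-compatible principal polarisation — NO HYPOTHESIS (THEOREM L′ at `39` = part 34b; dictionary = part 26b).
* §3 the rows: `nodd_thirtyNine_eq` (`N_odd` displayed), **`not_exists_principal_thirtyNine_plus` /`_minus`**
  (`C₊ = {χ₁₃ = +1} = {1,4,10,14,16,17,22,23,25,29,35,38}`, `C₋` its complement in the units: odd
  `|S_Φ ∩ C_± ∩ N_odd|` ⇒ NO) and **`not_exists_principal_thirtyNine_of_even`**: `|S_Φ ∩ {14,17,23,29,35,38}|` EVEN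
  ⇒ NO — `{14,17,23,29,35,38} = C₊ ∩ N_K` for BOTH `K = ℚ(√−3)` (`N_K = {t ≡ 2 (3)}`) and `K = ℚ(√−39)`, i.e.
  «`n₊₋(Φ)` even ⇒ not principally polarisable»: census b01.25 (A)'s NO classes at `39` (452 of the 924
  `K`-balanced types for each `K`), now hypothesis-free kernel theorems for the lattice `ℤ[ζ₃₉]`.

HONEST FRAMING: statements about Shimura's divisors of principal type on `ℂ^Φ/Φ(ℤ[ζ₃₉])` (the principal
lattice; `h(ℚ(ζ₃₉)) = 2`, other lattice classes are not treated); the YES direction («`n₊₋` odd ⇒ principal»,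
which needs the unit supply of sign rank `10`) is NOT proved here; nothing here is a statement about Hodge
classes, `W_K`, general members or HC; `HC_CM` is used nowhere.  No `def`, no named fact, no `sorry`.

References: [cite: Shimura1998, §14.3 Prop. 4–5, pp. 103–104]; [cite: Washington1997, §8.1 and Lemma 4.7–4.8
(Gauss sums)]; census b01.25 (A) (seat-derived).
-/

noncomputable section

open Polynomial NumberField Complex Finset
open scoped nonZeroDivisors Real

namespace Summit.HodgeConjecture.Ring2WeilCoverage.CyclotomicTwistedLevel39

open Literature.AlgebraicGeometry.Motives (CMType)
open Literature.AlgebraicGeometry.HodgeTheory (IsCMTypeSet)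
open Literature.AlgebraicGeometry.ComplexMultiplication.CyclotomicCMType
open Literature.NumberTheory.ComplexMultiplication
open Summit.HodgeConjecture.Ring2WeilCoverage.CyclotomicTwistedObstruction
open Summit.HodgeConjecture.Ring2WeilCoverage.RelativeNormPositivityLevels
open Summit.HodgeConjecture.Ring2WeilCoverage.ResidueDictionaryPiecesB (re_embedding_sqrtThirteen_neg_iff)
open Summit.HodgeConjecture.Ring2WeilCoverage.CyclotomicUnconditionalSqrtFive (sq_gaussThree complexConj_gaussThree)
open Summit.HodgeConjecture.Ring2WeilCoverage.RealQuadraticUnitNorm (complexConj_eq_inv_of_pow_eq_one)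

/-! ### §0 Row bookkeeping: from `n_C(Φ)` and the constant `|C ∩ (N_odd ∖ N_K)|` to the odd twisted count -/

section Rows

variable {m : ℕ} [NeZero m]

/-- **Row bookkeeping** (every level): `S` a CM type set (the residue set `S_Φ`), `C_b` the residues of one class
(`t ∈ C_b ↔ (P t ↔ b)` on units, `C_b` stable under negation), `N_odd` and `N_K` CM type sets, `E = C_b ∩ N_K`.  If
`|S ∩ E| + |C_b ∩ (N_odd ∖ N_K)|` is odd then `|{t ∈ S : P t ↔ b} ∩ N_odd|` is odd (part 35's twisted pair count:
`|S ∩ C ∩ N_odd| ≡ |S ∩ C ∩ N_K| + |C ∩ (N_odd ∖ N_K)|`).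
research route conditional on HC_CM; not a corollary; Q11.4-sentence-2 already refuted in dim ≥ 3. [folklore] -/
theorem odd_card_filter_inter_of {S Cb NoddE NK E : Finset (ZMod m)} {P : ZMod m → Prop} [DecidablePred P]
    {b : Prop} [Decidable b] (hS : IsCMTypeSet m S) (hCb : ∀ t : ZMod m, t.val.Coprime m → (t ∈ Cb ↔ (P t ↔ b)))
    (hNoddSet : IsCMTypeSet m NoddE) (hNK : IsCMTypeSet m NK) (hCsym : ∀ t ∈ Cb, -t ∈ Cb) (hE : Cb ∩ NK = E)
    (hrow : Odd ((S ∩ E).card + (Cb ∩ (NoddE \ NK)).card)) :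
    Odd ((S.filter fun t => (P t ↔ b)) ∩ NoddE).card := by
  have hset : (S.filter fun t => (P t ↔ b)) ∩ NoddE = S ∩ Cb ∩ NoddE := by
    ext t
    simp only [mem_inter, mem_filter]
    constructor
    · rintro ⟨⟨htS, hP⟩, htN⟩
      exact ⟨⟨htS, (hCb t (hS.1 t htS)).mpr hP⟩, htN⟩
    · rintro ⟨⟨htS, htC⟩, htN⟩
      exact ⟨⟨htS, (hCb t (hS.1 t htS)).mp htC⟩, htN⟩
  rw [hset, Nat.odd_iff, card_inter_mod_two_eq_on hS hNoddSet hNK hCsym, Finset.inter_assoc, hE, ← Nat.odd_iff]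
  exact hrow

end Rows

/-! ### §1 The elements of `ℚ(ζ₃₉)⁺`: `√13` (Gauss sum of 13) and `w = 2(1 + 2ω)(π₀ − π₂)`, `w² = 78 − 18√13` -/

section Elements

variable {K : Type} [Field K]

/-- **`(1 + 2(η + η³ + η⁴ + η⁹ + η¹⁰ + η¹²))² = 13`** for a primitive 13th root of unity `η` (`{1,3,4,9,10,12}` = the
quadratic residues mod `13`; the quadratic Gauss sum, `13 ≡ 1 (mod 4)`).
research route conditional on HC_CM; not a corollary; Q11.4-sentence-2 already refuted in dim ≥ 3. [cite: Washington1997, Lemma 4.8] -/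
theorem sq_gaussThirteen {η : K} (hη : IsPrimitiveRoot η 13) :
    (1 + 2 * (η + η ^ 3 + η ^ 4 + η ^ 9 + η ^ 10 + η ^ 12)) ^ 2 = (13 : K) := by
  have hG := hη.geom_sum_eq_zero (by norm_num : 1 < 13)
  simp only [Finset.sum_range_succ, Finset.sum_range_zero, zero_add, pow_zero, pow_one] at hG
  have h13 : η ^ 13 = 1 := hη.pow_eq_one
  linear_combination (12 : K) * hG + ((24 : K) + (8 : K) * η + (8 : K) * η ^ 2 + (8 : K) * η ^ 3 +
    (4 : K) * η ^ 5 + (8 : K) * η ^ 6 + (4 : K) * η ^ 7 + (8 : K) * η ^ 8 + (8 : K) * η ^ 9 +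
    (4 : K) * η ^ 11) * h13

/-- **`2(π₀ − π₂)² = −(13 − 3·(1 + 2Σ_{QR} η^a))`** for the Gauss periods `π₀ = η + η³ + η⁹`, `π₂ = η⁴ + η¹² + η¹⁰`
of length `3` (`π₂ = π̄₀`; `(π₀ − π₂)² = −(13 − 3√13)/2` generates, with `√13`, the imaginary cyclic quartic field of
conductor `13`).
research route conditional on HC_CM; not a corollary; Q11.4-sentence-2 already refuted in dim ≥ 3. [folklore] -/
theorem two_mul_sq_piDiff {η : K} (hη : IsPrimitiveRoot η 13) :
    2 * ((η + η ^ 3 + η ^ 9) - (η ^ 4 + η ^ 12 + η ^ 10)) ^ 2 =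
      -(13 - 3 * (1 + 2 * (η + η ^ 3 + η ^ 4 + η ^ 9 + η ^ 10 + η ^ 12))) := by
  have hG := hη.geom_sum_eq_zero (by norm_num : 1 < 13)
  simp only [Finset.sum_range_succ, Finset.sum_range_zero, zero_add, pow_zero, pow_one] at hG
  have h13 : η ^ 13 = 1 := hη.pow_eq_one
  linear_combination (-2 : K) * hG + ((-12 : K) + (4 : K) * η + (-4 : K) * η ^ 2 + (4 : K) * η ^ 3 +
    (2 : K) * η ^ 5 + (-4 : K) * η ^ 6 + (2 : K) * η ^ 7 + (-4 : K) * η ^ 8 + (4 : K) * η ^ 9 +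
    (2 : K) * η ^ 11) * h13

variable [NumberField K] [IsCMField K]

/-- **Conjugation fixes the Gauss sum of `13`** (`η ↦ η¹²` permutes the residues, `−1` being a residue mod `13`).
research route conditional on HC_CM; not a corollary; Q11.4-sentence-2 already refuted in dim ≥ 3. [folklore] -/
theorem complexConj_gaussThirteen {η : K} (hη : IsPrimitiveRoot η 13) :
    IsCMField.complexConj K (1 + 2 * (η + η ^ 3 + η ^ 4 + η ^ 9 + η ^ 10 + η ^ 12)) =
      1 + 2 * (η + η ^ 3 + η ^ 4 + η ^ 9 + η ^ 10 + η ^ 12) := by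
  have h13 : η ^ 13 = 1 := hη.pow_eq_one
  have hc : IsCMField.complexConj K η = η ^ 12 := by
    rw [complexConj_eq_inv_of_pow_eq_one (by norm_num) h13]
    exact inv_eq_of_mul_eq_one_right (by linear_combination h13)
  simp only [map_add, map_one, map_mul, map_ofNat, map_pow, hc]
  linear_combination ((2 : K) * η + (2 : K) * η ^ 3 + (2 : K) * η ^ 4 + (2 : K) * η ^ 9 +
    (2 : K) * η ^ 10 + (2 : K) * η ^ 14 + (2 : K) * η ^ 16 + (2 : K) * η ^ 17 + (2 : K) * η ^ 22 +
    (2 : K) * η ^ 23 + (2 : K) * η ^ 27 + (2 : K) * η ^ 29 + (2 : K) * η ^ 30 + (2 : K) * η ^ 35 +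
    (2 : K) * η ^ 40 + (2 : K) * η ^ 42 + (2 : K) * η ^ 43 + (2 : K) * η ^ 53 + (2 : K) * η ^ 55 +
    (2 : K) * η ^ 56 + (2 : K) * η ^ 66 + (2 : K) * η ^ 68 + (2 : K) * η ^ 69 + (2 : K) * η ^ 79 +
    (2 : K) * η ^ 81 + (2 : K) * η ^ 82 + (2 : K) * η ^ 92 + (2 : K) * η ^ 94 + (2 : K) * η ^ 95 +
    (2 : K) * η ^ 105 + (2 : K) * η ^ 107 + (2 : K) * η ^ 118 + (2 : K) * η ^ 131) * h13

/-- **Conjugation negates `π₀ − π₂`** (`η ↦ η¹²` swaps the periods `π₀ = η + η³ + η⁹` and `π₂ = η⁴ + η¹² + η¹⁰`).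
research route conditional on HC_CM; not a corollary; Q11.4-sentence-2 already refuted in dim ≥ 3. [folklore] -/
theorem complexConj_piDiff {η : K} (hη : IsPrimitiveRoot η 13) :
    IsCMField.complexConj K ((η + η ^ 3 + η ^ 9) - (η ^ 4 + η ^ 12 + η ^ 10)) =
      -((η + η ^ 3 + η ^ 9) - (η ^ 4 + η ^ 12 + η ^ 10)) := by
  have h13 : η ^ 13 = 1 := hη.pow_eq_one
  have hc : IsCMField.complexConj K η = η ^ 12 := by
    rw [complexConj_eq_inv_of_pow_eq_one (by norm_num) h13]
    exact inv_eq_of_mul_eq_one_right (by linear_combination h13)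
  simp only [map_add, map_sub, map_pow, hc]
  linear_combination ((-1 : K) * η + (-1 : K) * η ^ 3 + (1 : K) * η ^ 4 + (-1 : K) * η ^ 9 +
    (1 : K) * η ^ 10 + (-1 : K) * η ^ 14 + (-1 : K) * η ^ 16 + (1 : K) * η ^ 17 + (-1 : K) * η ^ 22 +
    (1 : K) * η ^ 23 + (-1 : K) * η ^ 27 + (-1 : K) * η ^ 29 + (1 : K) * η ^ 30 + (-1 : K) * η ^ 35 +
    (-1 : K) * η ^ 40 + (-1 : K) * η ^ 42 + (1 : K) * η ^ 43 + (-1 : K) * η ^ 53 + (-1 : K) * η ^ 55 +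
    (1 : K) * η ^ 56 + (-1 : K) * η ^ 66 + (-1 : K) * η ^ 68 + (1 : K) * η ^ 69 + (-1 : K) * η ^ 79 +
    (-1 : K) * η ^ 81 + (1 : K) * η ^ 82 + (-1 : K) * η ^ 92 + (-1 : K) * η ^ 94 + (1 : K) * η ^ 95 +
    (-1 : K) * η ^ 105 + (-1 : K) * η ^ 107 + (-1 : K) * η ^ 118 + (-1 : K) * η ^ 131) * h13

end Elements

/-! ### §2 The twisted NO verdict at `M = 39`, hypothesis-free -/

section Level39

variable {K : Type} [Field K] [NumberField K] [IsCMField K] [IsCyclotomicExtension {39} ℚ K] {ζ : K}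

/-- `𝐞(t) = exp(2πi t/39) ∈ ℂ` (`ZMod.toCircle`). -/
local notation3 (prettyPrint := false) "𝐞 " t:max => ((ZMod.toCircle t : Circle) : ℂ)

/-- The census's set `N_odd` at `39` (unit residues at odd positions), as a filter. -/
local notation3 (prettyPrint := false) "Nodd" =>
  (Finset.univ.filter fun t : ZMod 39 => t.val.Coprime 39 ∧
    Even (Finset.card (Finset.filter (fun s : ZMod 39 => s.val.Coprime 39 ∧ s.val < t.val) Finset.univ)))

/-- The dictionary predicate of part 26b for `√13`: «`t` is a non-residue mod `13`» (`χ₁₃(t) = −1`). -/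
local notation3 (prettyPrint := false) "NR13 " t:max =>
  (({1, 3, 4, 9, 10, 12} : Finset (ZMod 13)).image (· * (((ZMod.val t : ℕ) : ℕ) : ZMod 13)) =
    ({2, 5, 6, 7, 8, 11} : Finset (ZMod 13)))

open scoped Classical in
/-- **THE TWISTED NO VERDICT AT `M = 39` (no hypothesis).**  For any `K` with `IsCyclotomicExtension {39} ℚ K`,
`[IsCMField K]`, `ζ` a primitive 39th root of unity, any CM type `Φ` with residue set
`S_Φ = {t : ∃ σ ∈ Φ, σ ζ = 𝐞(t)}`, and either class `b` (`b = False`: `χ₁₃(t) = +1`; `b = True`: `χ₁₃(t) = −1`): if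
the number of `t ∈ S_Φ` at odd position (`t ∈ N_odd`) with `(χ₁₃(t) = −1 ↔ b)` is ODD, then the principal CM torus
`ℂ^Φ/Φ(ℤ[ζ₃₉])` carries NO `ι`-compatible principal polarisation.  Ingredients: `s = √13`, `w = 2(1 + 2ω)(π₀ − π₂)`
in `K⁺` (§1), `w² = 78 − 18s`; THEOREM L′ «`N_{K⁺/ℚ(√13)}(v) ≫ 0` for every unit `v`» = part 34b; the dictionary
`Re σ_t(√13) < 0 ↔ χ₁₃(t) = −1` = part 26b; the engine = part 35.
research route conditional on HC_CM; not a corollary; Q11.4-sentence-2 already refuted in dim ≥ 3. [cite: Shimura1998, §14.3 Prop. 5, p. 104] -/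
theorem not_exists_principal_thirtyNine_of_odd_on (hζ : IsPrimitiveRoot ζ 39) (Φ : CMType K) (b : Prop)
    [Decidable b]
    (hodd : Odd ((((Finset.univ.filter fun t : ZMod 39 => ∃ σ ∈ Φ.1, σ ζ = 𝐞 t).filter
      fun t => (NR13 t ↔ b)) ∩ Nodd).card)) :
    ¬ ∃ ζ' : K, IsCMField.complexConj K ζ' = -ζ' ∧ (∀ φ : Φ.1, 0 < (φ.1 ζ').im) ∧
        CMTypeLattice.IsOfType (1 : (FractionalIdeal (𝓞 K)⁰ K)ˣ) ζ' ⊤ := by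
  classical
  have hg : Nat.totient 39 = 2 * (11 + 1) := by decide
  have hη : IsPrimitiveRoot (ζ ^ 3) 13 := hζ.pow (by norm_num) (by norm_num)
  have hω : IsPrimitiveRoot (ζ ^ 13) 3 := hζ.pow (by norm_num) (by norm_num)
  -- the elements `s = √13`, `w = 2(1 + 2ω)(π₀ − π₂)` of `K`
  set s₀ : K := 1 + 2 * (ζ ^ (39 / 13) + ζ ^ (39 / 13 * 3) + ζ ^ (39 / 13 * 4) + ζ ^ (39 / 13 * 9) +
    ζ ^ (39 / 13 * 10) + ζ ^ (39 / 13 * 12)) with hs₀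
  have hs₀eq : s₀ = 1 + 2 * (ζ ^ 3 + (ζ ^ 3) ^ 3 + (ζ ^ 3) ^ 4 + (ζ ^ 3) ^ 9 + (ζ ^ 3) ^ 10 + (ζ ^ 3) ^ 12) := by
    have h3 : (39 / 13 : ℕ) = 3 := by norm_num
    rw [hs₀, h3]; ring
  set D : K := (ζ ^ 3 + (ζ ^ 3) ^ 3 + (ζ ^ 3) ^ 9) - ((ζ ^ 3) ^ 4 + (ζ ^ 3) ^ 12 + (ζ ^ 3) ^ 10) with hD
  set w₀ : K := 2 * (1 + 2 * ζ ^ 13) * D with hw₀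
  have hsreal : IsCMField.complexConj K s₀ = s₀ := by rw [hs₀eq]; exact complexConj_gaussThirteen hη
  have hwreal : IsCMField.complexConj K w₀ = w₀ := by
    rw [hw₀, map_mul, map_mul, map_ofNat, complexConj_gaussThree hω, hD, complexConj_piDiff hη]; ring
  have hs2 : s₀ ^ 2 = 13 := by rw [hs₀eq]; exact sq_gaussThirteen hη
  have hw2 : w₀ ^ 2 = 78 - 18 * s₀ := by
    have A := sq_gaussThree hω
    have B := two_mul_sq_piDiff hη
    rw [hs₀eq, hw₀, hD]
    rw [← hD] at B ⊢
    linear_combination (4 * D ^ 2) * A - 6 * B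
  -- in `K⁺`
  set s : maximalRealSubfield K := ⟨s₀, (IsCMField.complexConj_eq_self_iff K s₀).mp hsreal⟩ with hs
  set w : maximalRealSubfield K := ⟨w₀, (IsCMField.complexConj_eq_self_iff K w₀).mp hwreal⟩ with hw
  have hs2' : s ^ 2 = 13 := by apply Subtype.ext; push_cast; exact hs2
  have hw2' : w ^ 2 = 78 - 18 * s := by apply Subtype.ext; push_cast; exact hw2
  have hsK : (s : K) = s₀ := rfl
  have hs2K : (s : K) ^ 2 = ((13 : ℕ) : K) := by rw [hsK, hs2]; norm_num
  -- THEOREM L′ at 39 (part 34b) and the dictionary (part 26b)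
  have hN : ∀ v : (𝓞 (maximalRealSubfield K))ˣ, ∀ σ : maximalRealSubfield K →+* ℂ,
      0 < (σ (algebraMap (IntermediateField.adjoin ℚ {s}) (maximalRealSubfield K)
        (Algebra.norm (IntermediateField.adjoin ℚ {s})
          (((v : 𝓞 (maximalRealSubfield K)) : maximalRealSubfield K))))).re :=
    fun v σ => re_embedding_relNorm_pos_thirteen hs2' hw2' v σ
  have hdict : ∀ {φ : K →+* ℂ} {t : ZMod 39}, φ ζ = 𝐞 t → t.val.Coprime 39 →
      ((((φ (s : K)).re < 0 ↔ NR13 t) ∧ (φ (s : K)).re ≠ 0) ∧ (φ (s : K)).im = 0) :=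
    fun hφ ht => re_embedding_sqrtThirteen_neg_iff (n := 39) (by norm_num) hφ ht
  exact not_exists_principal_of_relNorm_pos_of_odd_on hζ hg Φ s hs2K (fun t : ZMod 39 => NR13 t) hdict hN b
    hodd

/-! ### §3 The rows: `N_odd`, the classes `C_± = {χ₁₃ = ±1}`, and `C₊ ∩ N_K = {14, 17, 23, 29, 35, 38}` -/

/-- `N_odd` at `39` displayed: the unit residues at odd positions `u₁, u₃, …, u₂₃`. [folklore] -/
theorem nodd_thirtyNine_eq : Nodd = ({1, 4, 7, 10, 14, 17, 20, 23, 28, 31, 34, 37} : Finset (ZMod 39)) := by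
  decide

/-- The class `C₊ = {t : χ₁₃(t) = +1}` (`= {1,4,10,14,16,17,22,23,25,29,35,38}`) and `C₋ = {χ₁₃(t) = −1}`
(`= {2,5,7,8,11,19,20,28,31,32,34,37}`) through the dictionary predicate; both stable under negation; the CM type
sets `N_odd` and `N_{ℚ(√−3)} = {t ≡ 2 (3)}`; `C₊ ∩ N_{ℚ(√−3)} = {14,17,23,29,35,38}`, `|C₊ ∩ (N_odd ∖ N_{ℚ(√−3)})| = 3`,
`|C₋ ∩ (N_odd ∖ N_{ℚ(√−3)})| = 5` — all by `decide`. [folklore] -/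
theorem classes_thirtyNine :
    (∀ t : ZMod 39, t.val.Coprime 39 →
      (t ∈ ({1, 4, 10, 14, 16, 17, 22, 23, 25, 29, 35, 38} : Finset (ZMod 39)) ↔ (NR13 t ↔ False))) ∧
    (∀ t : ZMod 39, t.val.Coprime 39 →
      (t ∈ ({2, 5, 7, 8, 11, 19, 20, 28, 31, 32, 34, 37} : Finset (ZMod 39)) ↔ (NR13 t ↔ True))) ∧
    (∀ t ∈ ({1, 4, 10, 14, 16, 17, 22, 23, 25, 29, 35, 38} : Finset (ZMod 39)),
      -t ∈ ({1, 4, 10, 14, 16, 17, 22, 23, 25, 29, 35, 38} : Finset (ZMod 39))) ∧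
    (∀ t ∈ ({2, 5, 7, 8, 11, 19, 20, 28, 31, 32, 34, 37} : Finset (ZMod 39)),
      -t ∈ ({2, 5, 7, 8, 11, 19, 20, 28, 31, 32, 34, 37} : Finset (ZMod 39))) ∧
    IsCMTypeSet 39 ({1, 4, 7, 10, 14, 17, 20, 23, 28, 31, 34, 37} : Finset (ZMod 39)) ∧
    IsCMTypeSet 39 ({2, 5, 8, 11, 14, 17, 20, 23, 29, 32, 35, 38} : Finset (ZMod 39)) ∧
    ({1, 4, 10, 14, 16, 17, 22, 23, 25, 29, 35, 38} : Finset (ZMod 39)) ∩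
        ({2, 5, 8, 11, 14, 17, 20, 23, 29, 32, 35, 38} : Finset (ZMod 39)) = {14, 17, 23, 29, 35, 38} ∧
    (({1, 4, 10, 14, 16, 17, 22, 23, 25, 29, 35, 38} : Finset (ZMod 39)) ∩
        (({1, 4, 7, 10, 14, 17, 20, 23, 28, 31, 34, 37} : Finset (ZMod 39)) \
          ({2, 5, 8, 11, 14, 17, 20, 23, 29, 32, 35, 38} : Finset (ZMod 39)))).card = 3 ∧
    (({2, 5, 7, 8, 11, 19, 20, 28, 31, 32, 34, 37} : Finset (ZMod 39)) ∩
        (({1, 4, 7, 10, 14, 17, 20, 23, 28, 31, 34, 37} : Finset (ZMod 39)) \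
          ({2, 5, 8, 11, 14, 17, 20, 23, 29, 32, 35, 38} : Finset (ZMod 39)))).card = 5 := by
  refine ⟨?_, ?_, by decide, by decide, by decide, by decide, by decide, by decide, by decide⟩
  · decide
  · decide

open scoped Classical in
/-- **Row `C₊` at `39`**: for any CM type `Φ`, if `|S_Φ ∩ C₊ ∩ N_odd|` is ODD (`C₊ = {t : χ₁₃(t) = +1} =
{1,4,10,14,16,17,22,23,25,29,35,38}`, `N_odd = {1,4,7,10,14,17,20,23,28,31,34,37}`), then `ℂ^Φ/Φ(ℤ[ζ₃₉])` carries
NO `ι`-compatible principal polarisation — the functional `λ = Σ_{χ₁₃(t)=+1}` of census b01.25 (A) in the kernel.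
research route conditional on HC_CM; not a corollary; Q11.4-sentence-2 already refuted in dim ≥ 3. [cite: Shimura1998, §14.3 Prop. 5, p. 104] -/
theorem not_exists_principal_thirtyNine_plus (hζ : IsPrimitiveRoot ζ 39) (Φ : CMType K)
    (hodd : Odd (((Finset.univ.filter fun t : ZMod 39 => ∃ σ ∈ Φ.1, σ ζ = 𝐞 t) ∩
      ({1, 4, 10, 14, 16, 17, 22, 23, 25, 29, 35, 38} : Finset (ZMod 39)) ∩
      ({1, 4, 7, 10, 14, 17, 20, 23, 28, 31, 34, 37} : Finset (ZMod 39))).card)) :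
    ¬ ∃ ζ' : K, IsCMField.complexConj K ζ' = -ζ' ∧ (∀ φ : Φ.1, 0 < (φ.1 ζ').im) ∧
        CMTypeLattice.IsOfType (1 : (FractionalIdeal (𝓞 K)⁰ K)ˣ) ζ' ⊤ := by
  classical
  obtain ⟨hCp, -, -, -, -, -, -, -, -⟩ := classes_thirtyNine
  have hS := isCMTypeSet_residueFilter hζ Φ
  refine not_exists_principal_thirtyNine_of_odd_on hζ Φ False ?_
  rw [nodd_thirtyNine_eq]
  have hset : ((Finset.univ.filter fun t : ZMod 39 => ∃ σ ∈ Φ.1, σ ζ = 𝐞 t).filter fun t => (NR13 t ↔ False)) ∩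
      ({1, 4, 7, 10, 14, 17, 20, 23, 28, 31, 34, 37} : Finset (ZMod 39)) =
      (Finset.univ.filter fun t : ZMod 39 => ∃ σ ∈ Φ.1, σ ζ = 𝐞 t) ∩
      ({1, 4, 10, 14, 16, 17, 22, 23, 25, 29, 35, 38} : Finset (ZMod 39)) ∩
      ({1, 4, 7, 10, 14, 17, 20, 23, 28, 31, 34, 37} : Finset (ZMod 39)) := by
    ext t
    simp only [mem_inter, mem_filter, mem_univ, true_and]
    constructor
    · rintro ⟨⟨htS, hP⟩, htN⟩
      have ht : t.val.Coprime 39 := hS.1 t (by simpa using htS)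
      exact ⟨⟨htS, (hCp t ht).mpr hP⟩, htN⟩
    · rintro ⟨⟨htS, htC⟩, htN⟩
      have ht : t.val.Coprime 39 := hS.1 t (by simpa using htS)
      exact ⟨⟨htS, (hCp t ht).mp htC⟩, htN⟩
  rw [hset]
  exact hodd

open scoped Classical in
/-- **Row `C₋` at `39`**: the same with `C₋ = {t : χ₁₃(t) = −1} = {2,5,7,8,11,19,20,28,31,32,34,37}` (the functional
`λ + parity`): `|S_Φ ∩ C₋ ∩ N_odd|` ODD ⇒ NO `ι`-compatible principal polarisation on `ℂ^Φ/Φ(ℤ[ζ₃₉])`.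
research route conditional on HC_CM; not a corollary; Q11.4-sentence-2 already refuted in dim ≥ 3. [cite: Shimura1998, §14.3 Prop. 5, p. 104] -/
theorem not_exists_principal_thirtyNine_minus (hζ : IsPrimitiveRoot ζ 39) (Φ : CMType K)
    (hodd : Odd (((Finset.univ.filter fun t : ZMod 39 => ∃ σ ∈ Φ.1, σ ζ = 𝐞 t) ∩
      ({2, 5, 7, 8, 11, 19, 20, 28, 31, 32, 34, 37} : Finset (ZMod 39)) ∩
      ({1, 4, 7, 10, 14, 17, 20, 23, 28, 31, 34, 37} : Finset (ZMod 39))).card)) :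
    ¬ ∃ ζ' : K, IsCMField.complexConj K ζ' = -ζ' ∧ (∀ φ : Φ.1, 0 < (φ.1 ζ').im) ∧
        CMTypeLattice.IsOfType (1 : (FractionalIdeal (𝓞 K)⁰ K)ˣ) ζ' ⊤ := by
  classical
  obtain ⟨-, hCm, -, -, -, -, -, -, -⟩ := classes_thirtyNine
  have hS := isCMTypeSet_residueFilter hζ Φ
  refine not_exists_principal_thirtyNine_of_odd_on hζ Φ True ?_
  rw [nodd_thirtyNine_eq]
  have hset : ((Finset.univ.filter fun t : ZMod 39 => ∃ σ ∈ Φ.1, σ ζ = 𝐞 t).filter fun t => (NR13 t ↔ True)) ∩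
      ({1, 4, 7, 10, 14, 17, 20, 23, 28, 31, 34, 37} : Finset (ZMod 39)) =
      (Finset.univ.filter fun t : ZMod 39 => ∃ σ ∈ Φ.1, σ ζ = 𝐞 t) ∩
      ({2, 5, 7, 8, 11, 19, 20, 28, 31, 32, 34, 37} : Finset (ZMod 39)) ∩
      ({1, 4, 7, 10, 14, 17, 20, 23, 28, 31, 34, 37} : Finset (ZMod 39)) := by
    ext t
    simp only [mem_inter, mem_filter, mem_univ, true_and]
    constructor
    · rintro ⟨⟨htS, hP⟩, htN⟩
      have ht : t.val.Coprime 39 := hS.1 t (by simpa using htS)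
      exact ⟨⟨htS, (hCm t ht).mpr hP⟩, htN⟩
    · rintro ⟨⟨htS, htC⟩, htN⟩
      have ht : t.val.Coprime 39 := hS.1 t (by simpa using htS)
      exact ⟨⟨htS, (hCm t ht).mp htC⟩, htN⟩
  rw [hset]
  exact hodd

open scoped Classical in
/-- **CENSUS ROWS `(39, ℚ(√−3))` AND `(39, ℚ(√−39))` — NO, HYPOTHESIS-FREE.**  For any `K` with
`IsCyclotomicExtension {39} ℚ K`, `[IsCMField K]`, `ζ` a primitive 39th root, and ANY CM type `Φ`: if
`n₊₋(Φ) := |S_Φ ∩ {14, 17, 23, 29, 35, 38}|` is EVEN, then `ℂ^Φ/Φ(ℤ[ζ₃₉])` carries NO `ι`-compatible principal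
polarisation.  Here `{14,17,23,29,35,38} = C₊ ∩ N_K = {t : χ₁₃(t) = +1, χ_K(t) = −1}` for BOTH `K = ℚ(√−3)`
(`N_K = {t ≡ 2 (mod 3)}`) and `K = ℚ(√−39)` (on `C₊`, `χ₋₃₉ = χ₋₃`), so this is census b01.25 (A)'s «`A_Φ` principal
⟹ `n₊₋(Φ)` odd» at `M = 39` for both `K` (the 452 NO classes among the 924 `K`-balanced types, each `K`), with no
balance hypothesis needed and no class field theory: `|S_Φ ∩ C₊ ∩ N_odd| ≡ n₊₋(Φ) + 3` (§0 with
`|C₊ ∩ (N_odd ∖ N_{ℚ(√−3)})| = 3`).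
research route conditional on HC_CM; not a corollary; Q11.4-sentence-2 already refuted in dim ≥ 3. [cite: Shimura1998, §14.3 Prop. 5, p. 104] -/
theorem not_exists_principal_thirtyNine_of_even (hζ : IsPrimitiveRoot ζ 39) (Φ : CMType K)
    (heven : Even (((Finset.univ.filter fun t : ZMod 39 => ∃ σ ∈ Φ.1, σ ζ = 𝐞 t) ∩
      ({14, 17, 23, 29, 35, 38} : Finset (ZMod 39))).card)) :
    ¬ ∃ ζ' : K, IsCMField.complexConj K ζ' = -ζ' ∧ (∀ φ : Φ.1, 0 < (φ.1 ζ').im) ∧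
        CMTypeLattice.IsOfType (1 : (FractionalIdeal (𝓞 K)⁰ K)ˣ) ζ' ⊤ := by
  classical
  obtain ⟨hCp, -, hCsym, -, hNoddSet, hNK, hE, hd, -⟩ := classes_thirtyNine
  have hS := isCMTypeSet_residueFilter hζ Φ
  refine not_exists_principal_thirtyNine_of_odd_on hζ Φ False ?_
  rw [nodd_thirtyNine_eq]
  refine odd_card_filter_inter_of hS hCp hNoddSet hNK hCsym hE ?_
  rw [hd, Nat.odd_add']
  exact ⟨fun _ => heven, fun _ => by decide⟩

end Level39

end Summit.HodgeConjecture.Ring2WeilCoverage.CyclotomicTwistedLevel39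

end
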